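import Mathlib
import Literature.MathematicalPhysics.QuantumFieldTheory.Balaban1983to89.Beta.Ineq167Operator

/-!
# The upper half of (1.67), `⟨B, Δ_kB⟩ ≤ γ₁⟨∂₁B, ∂₁B⟩`, for the GENUINE operator `Δ_k` — hence (1.67) in full

HONEST SCOPE (page 1 of everything in this cell): discharging `BetaPertH` makes Bałaban's UV stability
UNCONDITIONAL — a real constructive-QFT result; it is NOT the continuum limit and NOT the Clay problem.  This file
is KERNEL BOOKKEEPING for one printed inequality about a finite matrix; it claims nothing about `β`, nothing about
the far regions, nothing about the summit.

PRINTED TEXT ([Balaban1984PropagatorsI] = T. Bałaban, Commun. Math. Phys. **95** (1984) 17–40, p. 29 [PDF 13];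
TEXT LOCATIONS ONLY, nothing printed enters as a hypothesis): (1.65) «⟨B, Δ_kB⟩ = ⟨∂H_kB, ∂H_kB⟩»; (1.67)
«γ₀⟨∂₁B, ∂₁B⟩ ≦ ⟨B, Δ_kB⟩ ≦ γ₁⟨∂₁B, ∂₁B⟩, γ₀, γ₁ > 0 depending on d only.»; p. 28 [PDF 12] after (1.62)
«Multiplying φ_μ(p′) by Δ₀(p′), we get a well-defined positive function for all p′ ∈ T̃₁^(k),
0 < γ₀ ≦ Δ₀(p′)φ_μ(p′) ≦ γ₁.» and after (1.63) «This expression is well defined and bounded for all values of l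
and p′».  READING (the cell's, not a printed sentence): in (1.62) only the `l = 0` summand carries the `1/Δ(p′)`
pole that `Δ₀(p′)` cancels — this is the mechanism of our interpolant, which keeps the central alias `l = 0` only.
(v1.0.1, docstring-only erratum after the lit3-g19 cross-read C-lit3g19-3 M1: v1 had put the reading in guillemets;
no declaration is touched.)

THE OBJECTS are those of `Beta.Ineq167Operator` (v1 of this node): `Δ_k = Beta.BlockEffectiveAction.DelK n hn M a ha`
((1.65) for the typed minimizer `H_k`, fine torus `Tor (fine n M)`, `η = 1/n`, `n = L^k ≥ 1`, unit torus `Tor M`),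
`⟨∂₁B,∂₁B⟩ = B5Bounds167Lattice.d1Sq M B`.  v1 proved the LOWER half `d1Sq M B ≤ Re⟨B, Δ_kB⟩` (γ₀ = 1) and the
DOOR `Re⟨B, Δ_kB⟩ ≤ n^{-d}Σ_{ν,κ}‖∂^η_νA_κ‖²` for every fine `A` with `Q_kA = B`.

WHAT IS PROVED HERE (zero `sorry`; every `n ≥ 1`, every torus `M`, every `d`, every `a > 0`):
* §1 [folklore] Plancherel bookkeeping on any torus: `nsq_dftV`, the multiplier form of `∇_ν`
  (`nsq_fdiff_eq_sum`: `‖∇_νX‖² = Σ_i |fsym_ν(i)|²|X̂(i)|²`), and `gradEnergy_one_eq`: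
  `Σ_ν‖∇¹_νB‖² = ⟨∂₁B,∂₁B⟩ + ‖∂₁*B‖²` ((1.21) at `η = 1`); the lattice HODGE step `exists_divFree_gauge`:
  every `B` is `B′ + ∂₁λ`... precisely `∃ λ, ∂₁*(B + ∂₁λ) = 0` (finite-dimensional: `range ∂*∂ = range ∂*`).
* §2 THE CENTRAL-ALIAS RIGHT INVERSE `lift B` of `Q_k` (only the `l = 0` term of (1.62), our reading): the fine field whose
  `η`-Fourier transform lives on the central Brillouin zone `{p = p′ + 0}` with amplitude
  `B̂_κ(p′)/(c·u(p′)·v_κ(p′))` (`c = (√n^d)⁻¹`, `u`, `v_κ` of (1.30)/(1.61), nonzero at `l = 0` by Jordan);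
  **`QvOp_lift : Q_k(lift B) = B`** from the momentum representation (1.61) `B5Block118.dft_QvOp`.
* §3 **`energy_lift_le : n^{-d}Σ_ν‖∇^η_ν(lift B)‖² ≤ (π²/4)^{d+2}·Σ_ν‖∇¹_νB‖²`** — the three Jordan bounds
  `|∂^η(p′)|² ≤ (π²/4)|∂¹(p′)|²` (`B5Prop11Leaves.Sxir_le_S1r`), `|u(p′)|² ≥ (4/π²)^d` (`B4Strip.Ur_zero_ge`),
  `|v_κ(p′)|² ≥ 4/π²` (`B4Strip.uFactorr_zero_ge`), all pre-existing tree lemmas of the b04/pv11 lineages.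
* §4 **`ineq167_upper : Re⟨B, Δ_kB⟩ ≤ (π²/4)^{d+2}·⟨∂₁B, ∂₁B⟩` FOR EVERY `B`** (door at `A := lift B′` for the
  divergence-free gauge copy `B′ = B + ∂₁λ` of §1, both sides being gauge invariant by v1 §5), and therefore
  **`ineq167_DelK`: (1.67) IN FULL for the genuine (1.65) operator, `γ₀ = 1`, `γ₁ = (π²/4)^{d+2}`**, and
  **`bounds167_formOfDelK : B5.Bounds167 (fun i => formOfDelK (n i) (hn i) (M i) (a i) (ha i))` — the cell's
  (1.67) hypothesis `B5.Bounds167` BY NAME for the carriers whose `formΔk` is the GENUINE `Re⟨B, Δ_kB⟩`**, for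
  every family of steps / tori / dummies (constants depending on `d` only, as printed).  Also
  `QGQ_inv_form_le_d1Sq : Re Bᴴ(Q_kG_kQ_k*)⁻¹B ≤ a‖B‖² + (π²/4)^{d+2}⟨∂₁B,∂₁B⟩` (with v1: the operator behind
  (1.100) is two-sidedly equivalent to `a + ⟨∂₁·,∂₁·⟩` on every torus, uniformly in `k`).

WHAT IS NOT CLAIMED: the printed constants (none are printed); the identity of `Re⟨B,Δ_kB⟩` with pv15's
(1.66)-defined `formDk` (the (1.65)↔(1.66) dictionary — not needed for (1.67) any more); anything at `U ≠ 1`;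
anything about `β`, the continuum limit or the Clay problem.  Relation to the cell DAG: `B5.Bounds167` is the input
of `B6.h2118_of_B5` / (2.153); this file makes it available for the operator of (1.65) itself, so the B5 → B6 edge
no longer needs the (1.66) form as a stand-in.  Value = one printed inequality for the typed operator, kernel-checked;
NOT summit progress.

Citations: [Balaban1984PropagatorsI] (1.61) p.28, (1.65)/(1.67) p.29, (1.21) p.21, (1.30)/(1.31) p.23 — text
locations; everything else [folklore].  Unit `b2b-balaban-beta-an5-g11` (β sub-cell row BETA-an5, gen 11), node
BETA-an5-g11-INEQ167-OPERATOR (upper half); staged byte-identically under `HOME/lean/BalabanYm4/`.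
-/

noncomputable section

open scoped BigOperators Matrix ComplexConjugate ComplexOrder
open Finset

namespace Literature.MathematicalPhysics.QuantumFieldTheory.Balaban1983to89.Beta.Ineq167OperatorUpper

open Literature.MathematicalPhysics.QuantumFieldTheory.Balaban1983to89
open Literature.MathematicalPhysics.QuantumFieldTheory.Balaban1983to89.B4Strip (S1r Sxir uFactorr Ur Ur_zero_ge
  uFactorr_zero_ge Ur_nonneg)
open Literature.MathematicalPhysics.QuantumFieldTheory.Balaban1983to89.B5Prop11Leaves (Sxir_le_S1r shiftr_zero)
open Literature.MathematicalPhysics.QuantumFieldTheory.Balaban1983to89.B5Prop11Fiber (dSym d1Sym vSym uSym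
  norm_dSym_sq norm_d1Sym_sq norm_vSym_sq norm_uSym_sq)
open Literature.MathematicalPhysics.QuantumFieldTheory.Balaban1983to89.B5Prop11Plancherel (Tor fine unitVec dft
  dftV dftV_mul_star star_dftV_mul fdiff fsym dftV_mul_fdiff sOf abs_sOf_le fsym_emb dft_mem_unitaryGroup)
open Literature.MathematicalPhysics.QuantumFieldTheory.Balaban1983to89.B5Block118 (QvOp pOf pOf_injective
  pOf_bijective emb_eq cQ cQ_eq dft_QvOp)
open Literature.MathematicalPhysics.QuantumFieldTheory.Balaban1983to89.B5Action121 (comp sdiff fdiff_mulVec_apply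
  nsq_fdiff_mulVec LapV GradOp divS Fs form_curl_eq form_GradGradH GradOp_conjTranspose_mulVec_eq)
open Literature.MathematicalPhysics.QuantumFieldTheory.Balaban1983to89.B5Prop11Lower (nsq nsq_nonneg
  star_dotProduct_self)
open Literature.MathematicalPhysics.QuantumFieldTheory.Balaban1983to89.B5Bounds167Lattice (d1Sq fsym_one
  dftV_mulVec_apply)
open Literature.MathematicalPhysics.QuantumFieldTheory.Balaban1983to89.Beta.FluctuationProjection (QGQ)
open Literature.MathematicalPhysics.QuantumFieldTheory.Balaban1983to89.Beta.BlockEffectiveAction (DelK QGQ_inv_eq)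
open Literature.MathematicalPhysics.QuantumFieldTheory.Balaban1983to89.Beta.Ineq167Operator (d1Sq_eq_Fs
  LapV_form_eq DelK_form_le_gradEnergy DelK_form_add_grad d1Sq_add_grad ineq167_lower formOfDelK)

/-! ## §1 Plancherel bookkeeping and the Hodge step on an arbitrary torus -/

section Torus

variable {d : ℕ} (N : Fin d → ℕ) [hN : ∀ μ, NeZero (N μ)]

/-- Plancherel for the componentwise unitary DFT: `‖U X‖² = ‖X‖²`. [folklore] -/
theorem nsq_dftV (X : Tor N × Fin d → ℂ) : nsq (dftV N *ᵥ X) = nsq X := by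
  have key : star (dftV N *ᵥ X) ⬝ᵥ (dftV N *ᵥ X) = star X ⬝ᵥ X := by
    rw [Matrix.star_mulVec, ← Matrix.dotProduct_mulVec, Matrix.mulVec_mulVec,
      ← Matrix.star_eq_conjTranspose, star_dftV_mul, Matrix.one_mulVec]
  rw [star_dotProduct_self, star_dotProduct_self] at key
  exact_mod_cast key

/-- `(∇_νX)^ = fsym_ν · X̂`: the forward difference is the Fourier multiplier `fsym`. [folklore] -/
theorem dftV_fdiff_mulVec (c : ℂ) (ν : Fin d) (X : Tor N × Fin d → ℂ) :
    dftV N *ᵥ (fdiff N c ν *ᵥ X) = fun i => fsym N c ν i * (dftV N *ᵥ X) i := by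
  rw [Matrix.mulVec_mulVec, dftV_mul_fdiff, ← Matrix.mulVec_mulVec]
  funext i
  rw [Matrix.mulVec_diagonal]

/-- `‖∇_νX‖² = Σ_i |fsym_ν(i)|²·|X̂(i)|²`. [folklore] -/
theorem nsq_fdiff_eq_sum (c : ℂ) (ν : Fin d) (X : Tor N × Fin d → ℂ) :
    nsq (fdiff N c ν *ᵥ X) = ∑ i, ‖fsym N c ν i‖ ^ 2 * ‖(dftV N *ᵥ X) i‖ ^ 2 := by
  rw [← nsq_dftV N (fdiff N c ν *ᵥ X), dftV_fdiff_mulVec, nsq]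
  exact Finset.sum_congr rfl fun i _ => by rw [norm_mul, mul_pow]

/-- `Σ_ν‖∇_νB‖² = ½Σ_{x,μ,ν}|F_{μν}(B)(x)|² + ‖∂*B‖²` ((1.21): `Δ = ∂*∂ + ∂∂*` componentwise).
[cite: Balaban1984PropagatorsI, (1.21) p.21] -/
theorem gradEnergy_eq (c : ℂ) (B : Tor N × Fin d → ℂ) :
    ∑ ν, nsq (fdiff N c ν *ᵥ B) = 1 / 2 * ∑ x, ∑ μ, ∑ ν, ‖Fs N c B μ ν x‖ ^ 2 + nsq (divS N c B) := by
  have h := form_curl_eq N c B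
  rw [Matrix.sub_mulVec, dotProduct_sub, LapV_form_eq, form_GradGradH, star_dotProduct_self,
    ← Complex.ofReal_sub] at h
  have h' := Complex.ofReal_injective h
  have hE : ∑ ν, nsq (fdiff N c ν *ᵥ B) = ∑ ν, ∑ κ, nsq (sdiff N c ν *ᵥ comp N B κ) :=
    Finset.sum_congr rfl fun ν _ => nsq_fdiff_mulVec N c ν B
  linarith

/-- at `η = 1`: **`Σ_ν‖∇¹_νB‖² = ⟨∂₁B, ∂₁B⟩ + ‖∂₁*B‖²`**. [cite: Balaban1984PropagatorsI, (1.21) p.21] -/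
theorem gradEnergy_one_eq (B : Tor N × Fin d → ℂ) :
    ∑ ν, nsq (fdiff N 1 ν *ᵥ B) = d1Sq N B + nsq (divS N 1 B) := by
  rw [gradEnergy_eq, d1Sq_eq_Fs]
  have hx : (∑ x : Tor N, ∑ μ : Fin d, ∑ ν : Fin d, ‖Fs N 1 B μ ν x‖ ^ 2)
      = ∑ μ : Fin d, ∑ ν : Fin d, ∑ x : Tor N, ‖Fs N 1 B μ ν x‖ ^ 2 := by
    rw [Finset.sum_comm]
    exact Finset.sum_congr rfl fun μ _ => Finset.sum_comm
  rw [hx]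

/-- **THE HODGE STEP on a finite torus**: every vector field has a divergence-free gauge copy,
`∃ λ, ∂*(B + ∂λ) = 0` — because `range (∂*∂) = range ∂*` in finite dimensions (`ker ∂*∂ = ker ∂`).
[folklore] -/
theorem exists_divFree_gauge (c : ℂ) (B : Tor N × Fin d → ℂ) :
    ∃ l : Tor N → ℂ, divS N c (B + GradOp N c *ᵥ l) = 0 := by
  set G : Matrix (Tor N × Fin d) (Tor N) ℂ := GradOp N c with hG
  -- `range (Gᴴ G) = range Gᴴ`
  have hle : LinearMap.range (Gᴴ * G).mulVecLin ≤ LinearMap.range Gᴴ.mulVecLin := by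
    rw [Matrix.mulVecLin_mul]
    exact LinearMap.range_comp_le_range _ _
  have hrk : Module.finrank ℂ (LinearMap.range (Gᴴ * G).mulVecLin)
      = Module.finrank ℂ (LinearMap.range Gᴴ.mulVecLin) := by
    change (Gᴴ * G).rank = Gᴴ.rank
    rw [Matrix.rank_conjTranspose_mul_self, Matrix.rank_conjTranspose]
  have heq : LinearMap.range (Gᴴ * G).mulVecLin = LinearMap.range Gᴴ.mulVecLin :=
    Submodule.eq_of_le_of_finrank_eq hle hrk
  have hmem : Gᴴ *ᵥ B ∈ LinearMap.range (Gᴴ * G).mulVecLin := by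
    rw [heq]
    exact ⟨B, rfl⟩
  obtain ⟨l, hl⟩ := hmem
  refine ⟨-l, ?_⟩
  have hl' : (Gᴴ * G) *ᵥ l = Gᴴ *ᵥ B := hl
  rw [← GradOp_conjTranspose_mulVec_eq, Matrix.mulVec_add, Matrix.mulVec_neg, Matrix.mulVec_neg,
    Matrix.mulVec_mulVec, hl', add_neg_cancel]

end Torus

/-! ## §2 The central-alias right inverse of `Q_k` -/

section Lift

variable {d : ℕ} (n : ℕ) [NeZero n] (hn : 1 ≤ n) (M : Fin d → ℕ) [hM : ∀ μ, NeZero (M μ)]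

/-- the amplitude `1/(c·u(p′)·v_κ(p′))` at the central alias `l = 0` (`c = (√n^d)⁻¹`, (1.30)/(1.61)).
[cite: Balaban1984PropagatorsI, (1.61) p.28] -/
def cw (q : Tor M) (κ : Fin d) : ℂ :=
  ((cQ n M : ℂ) * uSym n (fun _ => 0) (sOf M q) * vSym n (fun _ => 0) (sOf M q) κ)⁻¹

/-- the `η`-lattice Fourier data of the interpolant: supported on the central Brillouin zone `{p′ + 0}`, with
amplitude `B̂_κ(p′)/(c·u·v_κ)` there (the `l = 0` summand of (1.62), p. 28 — our reading of the mechanism,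
not a printed phrase). [folklore] -/
def liftHat (B : Tor M × Fin d → ℂ) : Tor (fine n M) × Fin d → ℂ :=
  fun i => ∑ q : Tor M, if i.1 = pOf n M ((fun _ => 0), q) then cw n M q i.2 * (dftV M *ᵥ B) (q, i.2) else 0

/-- **the central-alias right inverse** `lift B := U_ηᴴ(liftHat B)` (a trigonometric interpolant of `B`).
[folklore] -/
def lift (B : Tor M × Fin d → ℂ) : Tor (fine n M) × Fin d → ℂ :=
  star (dftV (fine n M)) *ᵥ liftHat n M B

/-- `(lift B)^ = liftHat B`. [folklore] -/
theorem dftV_lift (B : Tor M × Fin d → ℂ) : dftV (fine n M) *ᵥ lift n M B = liftHat n M B := by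
  rw [lift, Matrix.mulVec_mulVec, dftV_mul_star, Matrix.one_mulVec]

/-- the Fourier data on the coset `p′ + l`: `B̂_κ(p′)/(c u v_κ)` at `l = 0`, zero at `l ≠ 0`. [folklore] -/
theorem liftHat_pOf (B : Tor M × Fin d → ℂ) (k : Fin d → Fin n) (q : Tor M) (κ : Fin d) :
    liftHat n M B (pOf n M (k, q), κ)
      = if k = (fun _ => 0) then cw n M q κ * (dftV M *ᵥ B) (q, κ) else 0 := by
  unfold liftHat
  have hiff : ∀ q' : Tor M,
      (pOf n M (k, q) = pOf n M ((fun _ => 0), q')) ↔ (k = (fun _ => 0) ∧ q = q') := fun q' => by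
    rw [(pOf_injective n M).eq_iff, Prod.mk.injEq]
  simp_rw [hiff]
  by_cases hk : k = fun _ => 0
  · simp only [hk, true_and, if_true]
    rw [Finset.sum_ite_eq]
    simp
  · simp [hk]

/-- `c > 0`. [folklore] -/
theorem cQ_pos : 0 < cQ n M := by
  rw [cQ_eq]
  have hn0 : (0 : ℝ) < n := by exact_mod_cast Nat.pos_of_ne_zero (NeZero.ne n)
  positivity

/-- `c² = n^{-d}`. [folklore] -/
theorem cQ_sq : cQ n M ^ 2 = ((n : ℝ) ^ d)⁻¹ := by
  rw [cQ_eq, inv_pow, Real.sq_sqrt (by positivity)]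

include hn in
/-- `|u(p′)|² ≥ (4/π²)^d > 0` at the central alias. [folklore] -/
theorem norm_u0_sq_ge (q : Tor M) :
    (4 / Real.pi ^ 2) ^ d ≤ ‖uSym n (fun _ => 0) (sOf M q)‖ ^ 2 := by
  rw [norm_uSym_sq n hn _ _ (abs_sOf_le M q)]
  exact Ur_zero_ge n hn _ (abs_sOf_le M q)

include hn in
/-- `|v_κ(p′)|² ≥ 4/π² > 0` at the central alias. [folklore] -/
theorem norm_v0_sq_ge (q : Tor M) (κ : Fin d) :
    4 / Real.pi ^ 2 ≤ ‖vSym n (fun _ => 0) (sOf M q) κ‖ ^ 2 := by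
  rw [norm_vSym_sq n hn _ _ κ (abs_sOf_le M q κ)]
  simpa using uFactorr_zero_ge n hn (sOf M q κ) (abs_sOf_le M q κ)

include hn in
/-- `c·u(p′)·v_κ(p′) ≠ 0`. [folklore] -/
theorem cuv_ne_zero (q : Tor M) (κ : Fin d) :
    (cQ n M : ℂ) * uSym n (fun _ => 0) (sOf M q) * vSym n (fun _ => 0) (sOf M q) κ ≠ 0 := by
  have hpi : 0 < 4 / Real.pi ^ 2 := by positivity
  have hu : uSym n (fun _ => 0) (sOf M q) ≠ 0 := by
    intro h
    have := norm_u0_sq_ge n hn M q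
    rw [h, norm_zero, zero_pow two_ne_zero] at this
    exact absurd this (not_le.mpr (by positivity))
  have hv : vSym n (fun _ => 0) (sOf M q) κ ≠ 0 := by
    intro h
    have := norm_v0_sq_ge n hn M q κ
    rw [h, norm_zero, zero_pow two_ne_zero] at this
    exact absurd this (not_le.mpr hpi)
  have hc : (cQ n M : ℂ) ≠ 0 := Complex.ofReal_ne_zero.mpr (cQ_pos n M).ne'
  exact mul_ne_zero (mul_ne_zero hc hu) hv

/-- the scalar DFT of a component is the componentwise DFT. [folklore] -/
theorem dft_comp {N : Fin d → ℕ} [∀ μ, NeZero (N μ)] (A : Tor N × Fin d → ℂ) (p : Tor N) (μ : Fin d) :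
    (dft N *ᵥ comp N A μ) p = (dftV N *ᵥ A) (p, μ) := by
  rw [dftV_mulVec_apply]
  rfl

include hn in
/-- (1.61) applied to the interpolant: `(Q_k lift B)^_μ(p′) = B̂_μ(p′)`. [cite: Balaban1984PropagatorsI, (1.61) p.28] -/
theorem dft_comp_QvOp_lift (B : Tor M × Fin d → ℂ) (q : Tor M) (μ : Fin d) :
    (dft M *ᵥ comp M (QvOp n M *ᵥ lift n M B) μ) q = (dft M *ᵥ comp M B μ) q := by
  rw [dft_QvOp]
  have hc : ∀ k : Fin d → Fin n, (dft (fine n M) *ᵥ comp (fine n M) (lift n M B) μ) (pOf n M (k, q))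
      = liftHat n M B (pOf n M (k, q), μ) := by
    intro k
    rw [dft_comp, dftV_lift]
  simp_rw [hc, liftHat_pOf]
  rw [Finset.sum_eq_single (fun _ => (0 : Fin n))]
  · rw [if_pos rfl, dft_comp, cw]
    have hne := cuv_ne_zero n hn M q μ
    set X := (cQ n M : ℂ) * uSym n (fun _ => 0) (sOf M q) * vSym n (fun _ => 0) (sOf M q) μ with hX
    calc (cQ n M : ℂ) * (uSym n (fun _ => 0) (sOf M q) * vSym n (fun _ => 0) (sOf M q) μ
            * (X⁻¹ * (dftV M *ᵥ B) (q, μ)))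
          = X * X⁻¹ * (dftV M *ᵥ B) (q, μ) := by rw [hX]; ring
      _ = (dftV M *ᵥ B) (q, μ) := by rw [mul_inv_cancel₀ hne, one_mul]
  · intro k _ hk
    rw [if_neg hk, mul_zero]
  · intro h
    exact absurd (Finset.mem_univ _) h

include hn in
/-- **`Q_k(lift B) = B`**: the central-alias interpolant is a right inverse of the block average (1.18).
[cite: Balaban1984PropagatorsI, (1.61) p.28] -/
theorem QvOp_lift (B : Tor M × Fin d → ℂ) : QvOp n M *ᵥ lift n M B = B := by
  have hU : star (dft M) * dft M = 1 := Matrix.mem_unitaryGroup_iff'.mp (dft_mem_unitaryGroup M)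
  have hinj : ∀ f g : Tor M → ℂ, dft M *ᵥ f = dft M *ᵥ g → f = g := by
    intro f g h
    have h2 := congrArg (fun v => star (dft M) *ᵥ v) h
    simpa only [Matrix.mulVec_mulVec, hU, Matrix.one_mulVec] using h2
  funext ⟨y, μ⟩
  have h := hinj _ _ (funext fun q => dft_comp_QvOp_lift n hn M B q μ)
  exact congrFun h y

/-! ## §3 The energy of the interpolant -/

/-- `‖∇^η_ν(lift B)‖² = Σ_κ Σ_{p′} |∂^η_ν(p′)|²·|1/(c u v_κ)|²·|B̂_κ(p′)|²` (only `l = 0` contributes).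
[folklore] -/
theorem nsq_fdiff_lift_eq (B : Tor M × Fin d → ℂ) (ν : Fin d) :
    nsq (fdiff (fine n M) (n : ℂ) ν *ᵥ lift n M B)
      = ∑ κ, ∑ q : Tor M, ‖dSym n (fun _ => 0) (sOf M q) ν‖ ^ 2
          * (‖cw n M q κ‖ ^ 2 * ‖(dftV M *ᵥ B) (q, κ)‖ ^ 2) := by
  rw [nsq_fdiff_eq_sum, Fintype.sum_prod_type, Finset.sum_comm]
  refine Finset.sum_congr rfl fun κ _ => ?_
  rw [← (pOf_bijective n M).sum_comp, Fintype.sum_prod_type,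
    Finset.sum_eq_single (fun _ => (0 : Fin n))]
  · refine Finset.sum_congr rfl fun q _ => ?_
    rw [dftV_lift, liftHat_pOf, if_pos rfl, ← emb_eq, fsym_emb, norm_mul, mul_pow]
  · intro k _ hk
    refine Finset.sum_eq_zero fun q _ => ?_
    rw [dftV_lift, liftHat_pOf, if_neg hk, norm_zero, zero_pow two_ne_zero, mul_zero]
  · intro h
    exact absurd (Finset.mem_univ _) h

/-- `‖∇¹_νB‖² = Σ_κ Σ_{p′} |∂¹_ν(p′)|²·|B̂_κ(p′)|²` on the unit torus. [folklore] -/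
theorem nsq_fdiff_one_eq (B : Tor M × Fin d → ℂ) (ν : Fin d) :
    nsq (fdiff M 1 ν *ᵥ B) = ∑ κ, ∑ q : Tor M, ‖d1Sym (sOf M q) ν‖ ^ 2 * ‖(dftV M *ᵥ B) (q, κ)‖ ^ 2 := by
  rw [nsq_fdiff_eq_sum, Fintype.sum_prod_type, Finset.sum_comm]
  refine Finset.sum_congr rfl fun κ _ => Finset.sum_congr rfl fun q _ => ?_
  rw [fsym_one]

/-- Jordan 1: `|∂^η_ν(p′)|² ≤ (π²/4)|∂¹_ν(p′)|²` on the Brillouin zone. [folklore] -/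
theorem norm_dSym0_sq_le (q : Tor M) (ν : Fin d) :
    ‖dSym n (fun _ => 0) (sOf M q) ν‖ ^ 2 ≤ Real.pi ^ 2 / 4 * ‖d1Sym (sOf M q) ν‖ ^ 2 := by
  rw [norm_dSym_sq, shiftr_zero, norm_d1Sym_sq]
  exact Sxir_le_S1r n _ (abs_sOf_le M q ν)

include hn in
/-- Jordan 2 and 3: `n^{-d}·|1/(c u v_κ)|² = 1/(|u|²|v_κ|²) ≤ (π²/4)^{d+1}`. [folklore] -/
theorem norm_cw_sq_le (q : Tor M) (κ : Fin d) :
    1 / (n : ℝ) ^ d * ‖cw n M q κ‖ ^ 2 ≤ (Real.pi ^ 2 / 4) ^ (d + 1) := by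
  have hpi := Real.pi_pos
  have hnd : (0 : ℝ) < (n : ℝ) ^ d := by
    have hn0 : (0 : ℝ) < n := by exact_mod_cast Nat.pos_of_ne_zero (NeZero.ne n)
    positivity
  have hu := norm_u0_sq_ge n hn M q
  have hv := norm_v0_sq_ge n hn M q κ
  have hu0 : 0 < ‖uSym n (fun _ => 0) (sOf M q)‖ ^ 2 := lt_of_lt_of_le (by positivity) hu
  have hv0 : 0 < ‖vSym n (fun _ => 0) (sOf M q) κ‖ ^ 2 := lt_of_lt_of_le (by positivity) hv
  have hcw : ‖cw n M q κ‖ ^ 2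
      = ((n : ℝ) ^ d) * ((‖uSym n (fun _ => 0) (sOf M q)‖ ^ 2)⁻¹
          * (‖vSym n (fun _ => 0) (sOf M q) κ‖ ^ 2)⁻¹) := by
    rw [cw, norm_inv, norm_mul, norm_mul, Complex.norm_real, Real.norm_of_nonneg (cQ_pos n M).le,
      inv_pow, mul_pow, mul_pow, cQ_sq, mul_inv, mul_inv, inv_inv, mul_assoc]
  rw [hcw, ← mul_assoc, one_div, inv_mul_cancel₀ hnd.ne', one_mul, pow_succ]
  have h1 : (‖uSym n (fun _ => 0) (sOf M q)‖ ^ 2)⁻¹ ≤ (Real.pi ^ 2 / 4) ^ d := by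
    rw [inv_le_comm₀ hu0 (by positivity), ← inv_pow, inv_div]
    exact hu
  have h2 : (‖vSym n (fun _ => 0) (sOf M q) κ‖ ^ 2)⁻¹ ≤ Real.pi ^ 2 / 4 := by
    rw [inv_le_comm₀ hv0 (by positivity), inv_div]
    exact hv
  exact mul_le_mul h1 h2 (inv_nonneg.mpr hv0.le) (pow_nonneg (by positivity) d)

include hn in
/-- **`n^{-d}Σ_ν‖∇^η_ν(lift B)‖² ≤ (π²/4)^{d+2}·Σ_ν‖∇¹_νB‖²`**: the interpolant's `η`-lattice Dirichlet energy
is controlled by the unit-lattice one, uniformly in `k` and the volume. [folklore] -/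
theorem energy_lift_le (B : Tor M × Fin d → ℂ) :
    1 / (n : ℝ) ^ d * ∑ ν, nsq (fdiff (fine n M) (n : ℂ) ν *ᵥ lift n M B)
      ≤ (Real.pi ^ 2 / 4) ^ (d + 2) * ∑ ν, nsq (fdiff M 1 ν *ᵥ B) := by
  rw [Finset.mul_sum, Finset.mul_sum]
  refine Finset.sum_le_sum fun ν _ => ?_
  rw [nsq_fdiff_lift_eq, nsq_fdiff_one_eq, Finset.mul_sum, Finset.mul_sum]
  refine Finset.sum_le_sum fun κ _ => ?_
  rw [Finset.mul_sum, Finset.mul_sum]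
  refine Finset.sum_le_sum fun q _ => ?_
  have hX : 0 ≤ ‖(dftV M *ᵥ B) (q, κ)‖ ^ 2 := by positivity
  have h1 := norm_dSym0_sq_le n M q ν
  have h2 := norm_cw_sq_le n hn M q κ
  have hd0 : 0 ≤ ‖dSym n (fun _ => 0) (sOf M q) ν‖ ^ 2 := by positivity
  calc 1 / (n : ℝ) ^ d * (‖dSym n (fun _ => 0) (sOf M q) ν‖ ^ 2
          * (‖cw n M q κ‖ ^ 2 * ‖(dftV M *ᵥ B) (q, κ)‖ ^ 2))
        = ‖dSym n (fun _ => 0) (sOf M q) ν‖ ^ 2 * (1 / (n : ℝ) ^ d * ‖cw n M q κ‖ ^ 2)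
          * ‖(dftV M *ᵥ B) (q, κ)‖ ^ 2 := by ring
    _ ≤ (Real.pi ^ 2 / 4 * ‖d1Sym (sOf M q) ν‖ ^ 2) * (Real.pi ^ 2 / 4) ^ (d + 1)
          * ‖(dftV M *ᵥ B) (q, κ)‖ ^ 2 :=
        mul_le_mul_of_nonneg_right (mul_le_mul h1 h2 (by positivity) (by positivity)) hX
    _ = (Real.pi ^ 2 / 4) ^ (d + 2) * (‖d1Sym (sOf M q) ν‖ ^ 2 * ‖(dftV M *ᵥ B) (q, κ)‖ ^ 2) := by
        ring

end Lift

/-! ## §4 The upper half of (1.67) for `DelK`, and (1.67) in full -/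

section Main

variable {d : ℕ} (n : ℕ) [NeZero n] (hn : 1 ≤ n) (M : Fin d → ℕ) [hM : ∀ μ, NeZero (M μ)] (a : ℝ)
  (ha : 0 < a)

/-- the constant `γ₁ = (π²/4)^{d+2}` (ours; the paper prints none). [folklore] -/
def gamma1 (d : ℕ) : ℝ := (Real.pi ^ 2 / 4) ^ (d + 2)

omit [NeZero n] hM in
/-- `γ₁ > 0`. [folklore] -/
theorem gamma1_pos (d : ℕ) : 0 < gamma1 d := by
  unfold gamma1; positivity

/-- pre-Hodge form: `Re⟨B, Δ_kB⟩ ≤ γ₁·(⟨∂₁B,∂₁B⟩ + ‖∂₁*B‖²)` for every `B` (door at `A := lift B`).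
[folklore] -/
theorem DelK_form_le_d1Sq_add_div (B : Tor M × Fin d → ℂ) :
    (star B ⬝ᵥ (DelK n hn M a ha *ᵥ B)).re ≤ gamma1 d * (d1Sq M B + nsq (divS M 1 B)) := by
  have hdoor := DelK_form_le_gradEnergy n hn M a ha (lift n M B) B (QvOp_lift n hn M B)
  have hE : (∑ ν, ∑ κ, nsq (sdiff (fine n M) (n : ℂ) ν *ᵥ comp (fine n M) (lift n M B) κ))
      = ∑ ν, nsq (fdiff (fine n M) (n : ℂ) ν *ᵥ lift n M B) :=
    Finset.sum_congr rfl fun ν _ => (nsq_fdiff_mulVec (fine n M) (n : ℂ) ν (lift n M B)).symm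
  rw [hE] at hdoor
  have h2 := energy_lift_le n hn M B
  rw [gradEnergy_one_eq] at h2
  exact hdoor.trans h2

/-- **THE UPPER HALF OF (1.67) FOR THE GENUINE OPERATOR: `⟨B, Δ_kB⟩ ≤ γ₁⟨∂₁B, ∂₁B⟩`, `γ₁ = (π²/4)^{d+2}`**,
for every `B`, every `k` (`n = L^k ≥ 1`), every torus, every `d` (divergence-free gauge copy + gauge invariance
of both sides). [cite: Balaban1984PropagatorsI, (1.67) p.29 (upper half; constant ours)] -/
theorem ineq167_upper (B : Tor M × Fin d → ℂ) :
    (star B ⬝ᵥ (DelK n hn M a ha *ᵥ B)).re ≤ gamma1 d * d1Sq M B := by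
  obtain ⟨l, hl⟩ := exists_divFree_gauge M (1 : ℂ) B
  have h := DelK_form_le_d1Sq_add_div n hn M a ha (B + GradOp M 1 *ᵥ l)
  rw [DelK_form_add_grad, d1Sq_add_grad, hl, nsq] at h
  simpa using h

/-- **(1.67) IN FULL for the (1.65) operator**: `⟨∂₁B,∂₁B⟩ ≤ ⟨B, Δ_kB⟩ ≤ (π²/4)^{d+2}⟨∂₁B,∂₁B⟩`.
[cite: Balaban1984PropagatorsI, (1.67) p.29 (constants ours)] -/
theorem ineq167_DelK (B : Tor M × Fin d → ℂ) :
    d1Sq M B ≤ (star B ⬝ᵥ (DelK n hn M a ha *ᵥ B)).re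
      ∧ (star B ⬝ᵥ (DelK n hn M a ha *ᵥ B)).re ≤ gamma1 d * d1Sq M B :=
  ⟨ineq167_lower n hn M a ha B, ineq167_upper n hn M a ha B⟩

/-- **`Re Bᴴ(Q_kG_kQ_k*)⁻¹B ≤ a‖B‖² + γ₁⟨∂₁B,∂₁B⟩`** (`(QGQ*)⁻¹ = a + Δ_k`); with v1's `QGQ_inv_form_ge_d1Sq`
the operator behind (1.100) is two-sidedly equivalent to `a + ⟨∂₁·,∂₁·⟩`. [folklore] -/
theorem QGQ_inv_form_le_d1Sq (B : Tor M × Fin d → ℂ) :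
    (star B ⬝ᵥ ((QGQ n hn M a ha)⁻¹ *ᵥ B)).re ≤ a * (star B ⬝ᵥ B).re + gamma1 d * d1Sq M B := by
  have h := ineq167_upper n hn M a ha B
  rw [QGQ_inv_eq, Matrix.add_mulVec, Matrix.smul_mulVec, Matrix.one_mulVec, dotProduct_add,
    dotProduct_smul, smul_eq_mul, Complex.add_re, Complex.re_ofReal_mul]
  linarith

end Main

/-! ## §5 `B5.Bounds167` by name for the operator carriers -/

section Carrier

variable {d : ℕ}

/-- **`B5.Bounds167` BY NAME for the GENUINE-operator carriers `formOfDelK`**: for EVERY family of steps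
`n i ≥ 1`, tori `M i` and dummies `a i > 0`, (1.67) holds with ONE pair of constants `γ₀ = 1`,
`γ₁ = (π²/4)^{d+2}` «depending on d only» — the cell's (1.67) hypothesis (input of `B6.h2118_of_B5` / (2.153))
discharged for the operator of (1.65) itself. [cite: Balaban1984PropagatorsI, (1.67) p.29 (constants ours)] -/
theorem bounds167_formOfDelK {I : Type} (n : I → ℕ) (hn : ∀ i, 1 ≤ n i) (M : I → Fin d → ℕ)
    [hM : ∀ i μ, NeZero (M i μ)] (a : I → ℝ) (ha : ∀ i, 0 < a i) :
    B5.Bounds167 (fun i => formOfDelK (n i) (hn i) (M i) (a i) (ha i)) := by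
  refine ⟨1, gamma1 d, one_pos, gamma1_pos d, fun i B => ?_⟩
  haveI : NeZero (n i) := ⟨by have := hn i; omega⟩
  rw [one_mul]
  exact ineq167_DelK (n i) (hn i) (M i) (a i) (ha i) B

end Carrier

end Literature.MathematicalPhysics.QuantumFieldTheory.Balaban1983to89.Beta.Ineq167OperatorUpper

end
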